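import Summits.QuantumFields.QCD.Theorems.SpectralDefectExtinctionWegnerEstimateBallSamplingPullback
import Summits.QuantumFields.QCD.Theorems.SpectralDefectExtinctionWegnerEstimateStubPortRigidity

/-!
# Stub `starRigidity` of line `Sketch` (skeleton "ResolventCell", gen 4) for crux
`SpectralDefectExtinction.WegnerEstimate` (item stmt-QuantumFields-8966)

The rigidity inequality (ii) of `stub_currentRigidity` for the INTERIOR-normalised min-functional
`badStar R R'` of the landed `…SketchDefs` (gen 4), with `c₀ = 1`, `k = 1` — a TAUTOLOGY of the infimum once the
pull-back of a genuine torus eigenvector is recognised as an admissible competitor: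

for an eigenvector `Γ₅ D_W(W, m₀, 1) ψ = λ ψ` (`|λ| ≤ 1`, `m₀ ∈ [−1, 0]`) on any torus and ANY configuration `W` (in the
stub: the glued one `glue_{x,R}(U, V)`), pull `ψ` back to the ball field `φ(y) = ψ(x + proj y)` (`y ∈ box (R+1)`).  Then
* the cube residual of `φ` vanishes (landed `ballSampling_residual_pullback_eq_zero`), so `residualSq R m₀ λ w φ = 0`;
* every cube current of `φ` is the corresponding torus current of `ψ` or `0` (landed
  `ballSampling_abs_ballCurrent_pullback_le`), so `currentSum R w φ ≤ Σ |J|`;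
* `boxMass ψ (image of box R') ≤ ballBoxMass R R' φ =: s` for `R' ≤ R + 1` (`starRigidity_boxMass_le_ballBoxMass`);
normalising `φ₁ = φ/√s` (both terms of the functional are 2-homogeneous) gives an admissible competitor of interior mass
`1`, whence `badStar R R' w ≤ currentSum R w φ / s` (`csInf_le`) and `badStar · boxMass ≤ badStar · s ≤ Σ |J|`
(`starRigidity_of_le`).  Written by the line lead (prover-line-stmt-QuantumFields-8966-c4-0).
-/

noncomputable section

namespace Summit.QuantumFields.QCD.Cruxes.WegnerEstimate.ResolventCell

open scoped Matrix BigOperators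
open Literature.MathematicalPhysics.QuantumLattice Literature.MathematicalPhysics.QuantumFieldTheory
  Literature.Probability.LatticeModels
open Matrix

/-! ### The pull-back ball field: interior mass, homogeneity, zero residual -/

/-- **Local mass on `x + box R'` is at most the interior mass of the pull-back ball field** (`R' ≤ R + 1`):
`boxMass ψ {x + proj y : y ∈ box R'} ≤ ballBoxMass R R' (pull-back of ψ)` — the right side is the sum over preimages. -/
theorem starRigidity_boxMass_le_ballBoxMass {R R' L : ℕ} [NeZero L] (hR : R' ≤ R + 1) (ψ : QuarkIdx L → ℂ)
    (x : TorusSite 4 L) :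
    boxMass ψ ((box 4 R').image fun y => x + Torus.proj L y) ≤
      ballBoxMass R R'
        (fun p : ↥(box 4 (R + 1)) × Fin 3 × Fin 4 => ψ (x + Torus.proj L (p.1 : Fin 4 → ℤ), p.2.1, p.2.2)) := by
  refine (ballSampling_boxMass_image_le ψ x (box 4 R')).trans (le_of_eq ?_)
  rw [ballBoxMass]
  refine Finset.sum_congr rfl fun y hy => ?_
  refine Finset.sum_congr rfl fun a _ => Finset.sum_congr rfl fun α _ => ?_
  rw [ballSampling_ballVal_pullback, if_pos (box_mono 4 hR hy)]

/-- The zero extension of the pull-back of `c • ψ` is `c` times that of the pull-back of `ψ`. -/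
theorem starRigidity_ballVal_pullback_smul {R L : ℕ} (c : ℝ) (x : TorusSite 4 L) (ψ : QuarkIdx L → ℂ) :
    ballVal (fun p : ↥(box 4 (R + 1)) × Fin 3 × Fin 4 =>
        (c : ℂ) * ψ (x + Torus.proj L (p.1 : Fin 4 → ℤ), p.2.1, p.2.2)) =
      fun y a α => (c : ℂ) * ballVal (fun p : ↥(box 4 (R + 1)) × Fin 3 × Fin 4 =>
        ψ (x + Torus.proj L (p.1 : Fin 4 → ℤ), p.2.1, p.2.2)) y a α := by
  funext y a α
  unfold ballVal
  split_ifs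
  · rfl
  · rw [mul_zero]

/-- `ballCurrent` is `latticeCurrent` of the zero extension (definitional). -/
theorem starRigidity_ballCurrent_eq_latticeCurrent {R : ℕ} (w : LinkData) (φ : BallField R) (y : Fin 4 → ℤ)
    (μ : Fin 4) (i : Fin 8) : ballCurrent w φ y μ i = latticeCurrent w (ballVal φ) y μ i := rfl

/-- Homogeneity of the cube current sum of pull-backs: `currentSum (pull (c • ψ)) = c² · currentSum (pull ψ)`. -/
theorem starRigidity_currentSum_pullback_smul {R L : ℕ} (c : ℝ) (x : TorusSite 4 L) (w : LinkData)
    (ψ : QuarkIdx L → ℂ) :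
    currentSum R w (fun p : ↥(box 4 (R + 1)) × Fin 3 × Fin 4 =>
        (c : ℂ) * ψ (x + Torus.proj L (p.1 : Fin 4 → ℤ), p.2.1, p.2.2)) =
      c ^ 2 * currentSum R w (fun p : ↥(box 4 (R + 1)) × Fin 3 × Fin 4 =>
        ψ (x + Torus.proj L (p.1 : Fin 4 → ℤ), p.2.1, p.2.2)) := by
  rw [currentSum, currentSum, Finset.mul_sum]
  refine Finset.sum_congr rfl fun y _ => ?_
  rw [Finset.mul_sum]
  refine Finset.sum_congr rfl fun μ _ => ?_
  rw [Finset.mul_sum]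
  refine Finset.sum_congr rfl fun i _ => ?_
  rw [starRigidity_ballCurrent_eq_latticeCurrent, starRigidity_ballCurrent_eq_latticeCurrent,
    starRigidity_ballVal_pullback_smul, portRigidity_latticeCurrent_smul, abs_mul, abs_of_nonneg (sq_nonneg c)]

/-- Homogeneity of the interior mass of pull-backs: `ballBoxMass (pull (c • ψ)) = c² · ballBoxMass (pull ψ)`. -/
theorem starRigidity_ballBoxMass_pullback_smul {R R' L : ℕ} (c : ℝ) (x : TorusSite 4 L) (ψ : QuarkIdx L → ℂ) :
    ballBoxMass R R' (fun p : ↥(box 4 (R + 1)) × Fin 3 × Fin 4 =>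
        (c : ℂ) * ψ (x + Torus.proj L (p.1 : Fin 4 → ℤ), p.2.1, p.2.2)) =
      c ^ 2 * ballBoxMass R R' (fun p : ↥(box 4 (R + 1)) × Fin 3 × Fin 4 =>
        ψ (x + Torus.proj L (p.1 : Fin 4 → ℤ), p.2.1, p.2.2)) := by
  rw [ballBoxMass, ballBoxMass, Finset.mul_sum]
  refine Finset.sum_congr rfl fun y _ => ?_
  rw [Finset.mul_sum]
  refine Finset.sum_congr rfl fun a _ => ?_
  rw [Finset.mul_sum]
  refine Finset.sum_congr rfl fun α _ => ?_
  rw [starRigidity_ballVal_pullback_smul, norm_mul, mul_pow, Complex.norm_real, Real.norm_eq_abs, sq_abs]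

/-- **Zero cube residual of a pulled-back eigenvector**, summed: `residualSq R m₀ λ w (pull ψ) = 0`. -/
theorem starRigidity_residualSq_pullback_eq_zero {R L : ℕ} [NeZero L] (x : TorusSite 4 L)
    (W : GaugeConfig 4 L SU3) (m₀ lam : ℝ) (ψ : QuarkIdx L → ℂ)
    (hψ : (spinorLift gammaFive * wilsonDirac (fundamentalRep (Fin 3)) W m₀ 1).mulVec ψ = (lam : ℂ) • ψ) :
    residualSq R m₀ lam (fun l => W (x + Torus.proj L l.1, l.2))
        (fun p : ↥(box 4 (R + 1)) × Fin 3 × Fin 4 => ψ (x + Torus.proj L (p.1 : Fin 4 → ℤ), p.2.1, p.2.2)) = 0 := by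
  rw [residualSq]
  refine Finset.sum_eq_zero fun y hy => Finset.sum_eq_zero fun a _ => Finset.sum_eq_zero fun α _ => ?_
  rw [ballSampling_residual_pullback_eq_zero x W m₀ lam ψ hψ hy a α, norm_zero, zero_pow two_ne_zero]

/-! ### The rigidity inequality for an arbitrary configuration -/

/-- **The interior rigidity inequality, `R' ≤ R + 1`, arbitrary torus configuration `W`** (links read around `x`;
right-hand side written with `fwdHop` / `su3Basis`, by `rfl` the registered current summands):
`badStar R R' w · boxMass ψ (x + box R') ≤ Σ_{y ∈ box R, μ, i} |J_{(x + proj y, μ), X_i}(ψ)|`. -/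
theorem starRigidity_of_le {R R' L : ℕ} [NeZero L] (hR : R' ≤ R + 1) (x : TorusSite 4 L) (m₀ : ℝ) (hm₀ : -1 ≤ m₀)
    (hm₀' : m₀ ≤ 0) (W : GaugeConfig 4 L SU3) (ψ : QuarkIdx L → ℂ) (lam : ℝ) (hlam : |lam| ≤ 1)
    (hψ : (spinorLift gammaFive * wilsonDirac (fundamentalRep (Fin 3)) W m₀ 1).mulVec ψ = (lam : ℂ) • ψ) :
    badStar R R' (fun l => W (x + Torus.proj L l.1, l.2)) *
        boxMass ψ ((box 4 R').image fun y => x + Torus.proj L y) ≤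
      ∑ y ∈ box 4 R, ∑ μ : Fin 4, ∑ i : Fin 8,
        |2 * (∑ a : Fin 3, ∑ b : Fin 3, ∑ α : Fin 4, ∑ β : Fin 4,
          star (ψ (x + Torus.proj L y, a, α)) * fwdHop μ α β *
            (((W (x + Torus.proj L y, μ) : SU3) : Matrix (Fin 3) (Fin 3) ℂ) * su3Basis i) a b *
            ψ (Literature.MathematicalPhysics.QuantumFieldTheory.Site.shift (x + Torus.proj L y) μ, b, β)).re| := by
  set w : LinkData := fun l => W (x + Torus.proj L l.1, l.2) with hw
  -- the pull-back ball field of a torus vector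
  set pull : (QuarkIdx L → ℂ) → BallField R := fun ψ' p => ψ' (x + Torus.proj L (p.1 : Fin 4 → ℤ), p.2.1, p.2.2)
    with hpull
  -- (A) mass ≤ interior mass of the pull-back
  have hmass : boxMass ψ ((box 4 R').image fun y => x + Torus.proj L y) ≤ ballBoxMass R R' (pull ψ) :=
    starRigidity_boxMass_le_ballBoxMass hR ψ x
  -- (B) currents ≤ RHS, termwise (each cube current of the pull-back is the torus current or `0`)
  have hcur : currentSum R w (pull ψ) ≤
      ∑ y ∈ box 4 R, ∑ μ : Fin 4, ∑ i : Fin 8,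
        |2 * (∑ a : Fin 3, ∑ b : Fin 3, ∑ α : Fin 4, ∑ β : Fin 4,
          star (ψ (x + Torus.proj L y, a, α)) * fwdHop μ α β *
            (((W (x + Torus.proj L y, μ) : SU3) : Matrix (Fin 3) (Fin 3) ℂ) * su3Basis i) a b *
            ψ (Literature.MathematicalPhysics.QuantumFieldTheory.Site.shift (x + Torus.proj L y) μ, b, β)).re| :=
    Finset.sum_le_sum fun y _ => Finset.sum_le_sum fun μ _ => Finset.sum_le_sum fun i _ =>
      ballSampling_abs_ballCurrent_pullback_le x W ψ y μ i
  have hRHS : 0 ≤ ∑ y ∈ box 4 R, ∑ μ : Fin 4, ∑ i : Fin 8,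
        |2 * (∑ a : Fin 3, ∑ b : Fin 3, ∑ α : Fin 4, ∑ β : Fin 4,
          star (ψ (x + Torus.proj L y, a, α)) * fwdHop μ α β *
            (((W (x + Torus.proj L y, μ) : SU3) : Matrix (Fin 3) (Fin 3) ℂ) * su3Basis i) a b *
            ψ (Literature.MathematicalPhysics.QuantumFieldTheory.Site.shift (x + Torus.proj L y) μ, b, β)).re| :=
    Finset.sum_nonneg fun _ _ => Finset.sum_nonneg fun _ _ => Finset.sum_nonneg fun _ _ => abs_nonneg _
  have hbad : 0 ≤ badStar R R' w := badStar_nonneg R R' w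
  have hs0 : 0 ≤ ballBoxMass R R' (pull ψ) := ballBoxMass_nonneg R R' _
  rcases hs0.eq_or_lt with hs | hs
  · -- the pull-back has no interior mass: so `boxMass = 0`
    calc badStar R R' w * boxMass ψ ((box 4 R').image fun y => x + Torus.proj L y)
        ≤ badStar R R' w * ballBoxMass R R' (pull ψ) := mul_le_mul_of_nonneg_left hmass hbad
      _ = 0 := by rw [← hs, mul_zero]
      _ ≤ _ := hRHS
  · -- normalise: `ψ₁ = ψ / √s` is an admissible competitor of interior mass `1` with zero residual
    set s := ballBoxMass R R' (pull ψ) with hs_def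
    set c : ℝ := (Real.sqrt s)⁻¹ with hc
    have hcs : c ^ 2 * s = 1 := by
      rw [hc, inv_pow, Real.sq_sqrt hs.le, inv_mul_cancel₀ hs.ne']
    obtain ⟨ψ₁, hψ₁⟩ : ∃ ψ₁ : QuarkIdx L → ℂ, ψ₁ = fun j => (c : ℂ) * ψ j := ⟨_, rfl⟩
    have hψ₁eig : (spinorLift gammaFive * wilsonDirac (fundamentalRep (Fin 3)) W m₀ 1).mulVec ψ₁ =
        (lam : ℂ) • ψ₁ := by
      have : ψ₁ = (c : ℂ) • ψ := by rw [hψ₁]; rfl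
      rw [this, Matrix.mulVec_smul, hψ, smul_comm]
    have hpull₁ : pull ψ₁ = fun p : ↥(box 4 (R + 1)) × Fin 3 × Fin 4 =>
        (c : ℂ) * ψ (x + Torus.proj L (p.1 : Fin 4 → ℤ), p.2.1, p.2.2) := by
      rw [hpull, hψ₁]
    have hnorm : ballBoxMass R R' (pull ψ₁) = 1 := by
      rw [hpull₁, starRigidity_ballBoxMass_pullback_smul, ← hs_def, hcs]
    have hcur₁ : currentSum R w (pull ψ₁) = c ^ 2 * currentSum R w (pull ψ) := by
      rw [hpull₁, starRigidity_currentSum_pullback_smul]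
    have hres : residualSq R m₀ lam w (pull ψ₁) = 0 :=
      starRigidity_residualSq_pullback_eq_zero x W m₀ lam ψ₁ hψ₁eig
    have hle : badStar R R' w ≤ c ^ 2 * currentSum R w (pull ψ) := by
      refine csInf_le ⟨0, ?_⟩ ⟨m₀, lam, pull ψ₁, hm₀, hm₀', hlam, hnorm, ?_⟩
      · rintro r ⟨m₁, lam₁, φ, -, -, -, -, rfl⟩
        exact add_nonneg (currentSum_nonneg R w φ) (residualSq_nonneg R m₁ lam₁ w φ)
      · rw [hres, add_zero, hcur₁]
    calc badStar R R' w * boxMass ψ ((box 4 R').image fun y => x + Torus.proj L y)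
        ≤ badStar R R' w * s := mul_le_mul_of_nonneg_left hmass hbad
      _ ≤ c ^ 2 * currentSum R w (pull ψ) * s := mul_le_mul_of_nonneg_right hle hs.le
      _ = currentSum R w (pull ψ) := by rw [mul_comm (c ^ 2), mul_assoc, hcs, mul_one]
      _ ≤ _ := hcur

/-! ### The stub -/

/-- **Stub `starRigidity`** (the rigidity inequality (ii) of `stub_currentRigidity` for `bad := badStar R R'`,
`c₀ = 1`, `k = 1`, inner radius `R' ≤ R`), verbatim the registered statement: for a genuine eigenvector `ψ`
(`|λ| ≤ 1`) of `Γ₅ D_W(glue_{x,R}(U, V), m₀, 1)` on any torus `L ≥ 2`,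
`badStar R R' (glue read around x) · boxMass ψ (x + box R') ≤ Σ_{y ∈ box R, μ, i} |J_{(x + proj y, μ), X_i}(ψ)|`. -/
theorem stub_starRigidity : ∀ (R R' : ℕ), R' ≤ R → ∀ (L : ℕ) [NeZero L], 2 ≤ L →
    ∀ (x : TorusSite 4 L) (m₀ : ℝ), -1 ≤ m₀ → m₀ ≤ 0 →
    ∀ (U V : GaugeConfig 4 L SU3) (ψ : QuarkIdx L → ℂ) (lam : ℝ), |lam| ≤ 1 →
    (spinorLift gammaFive * wilsonDirac (fundamentalRep (Fin 3))
        (fun e => if (∃ y ∈ box 4 R, e.1 = x + Torus.proj L y) then V e else U e) m₀ 1).mulVec ψ =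
      (lam : ℂ) • ψ →
    badStar R R' (fun l => (fun e : Edge 4 L => if (∃ y ∈ box 4 R, e.1 = x + Torus.proj L y) then V e else U e)
        (x + Torus.proj L l.1, l.2)) *
        boxMass ψ ((box 4 R').image fun y => x + Torus.proj L y) ≤
      ∑ y ∈ box 4 R, ∑ μ : Fin 4, ∑ i : Fin 8,
        |2 * (∑ a : Fin 3, ∑ b : Fin 3, ∑ α : Fin 4, ∑ β : Fin 4,
            star (ψ (x + Torus.proj L y, a, α)) *
              (gammaFive * ((-(1 / 2 : ℂ)) • ((1 : Matrix (Fin 4) (Fin 4) ℂ) - euclideanGamma μ))) α β *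
              ((((fun e : Edge 4 L => if (∃ y ∈ box 4 R, e.1 = x + Torus.proj L y) then V e else U e)
                    (x + Torus.proj L y, μ) : SU3) : Matrix (Fin 3) (Fin 3) ℂ) *
                  (![!![0, 1, 0; -1, 0, 0; 0, 0, 0], !![0, 0, 1; 0, 0, 0; -1, 0, 0],
                     !![0, 0, 0; 0, 0, 1; 0, -1, 0], !![0, Complex.I, 0; Complex.I, 0, 0; 0, 0, 0],
                     !![0, 0, Complex.I; 0, 0, 0; Complex.I, 0, 0],
                     !![0, 0, 0; 0, 0, Complex.I; 0, Complex.I, 0],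
                     !![Complex.I, 0, 0; 0, -Complex.I, 0; 0, 0, 0],
                     !![0, 0, 0; 0, Complex.I, 0; 0, 0, -Complex.I]] i : Matrix (Fin 3) (Fin 3) ℂ)) a b *
              ψ (Literature.MathematicalPhysics.QuantumFieldTheory.Site.shift (x + Torus.proj L y) μ,
                b, β)).re| := by
  intro R R' hR' L _ hL x m₀ hm₀ hm₀' U V ψ lam hlam hψ
  -- infer the glued configuration from `hψ`; `exact` closes the registered shape by unfolding `fwdHop`,
  -- `su3Basis` and β-reducing the glue
  have key := starRigidity_of_le (hR'.trans (Nat.le_succ R)) x m₀ hm₀ hm₀' _ ψ lam hlam hψ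
  exact key

end Summit.QuantumFields.QCD.Cruxes.WegnerEstimate.ResolventCell

end
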